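import Summits.BirchSwinnertonDyer.BirchSwinnertonDyer.Theorems.ManinLocalTwoThreePShiftEqualiserAllLevels
import Mathlib.LinearAlgebra.Dual.Lemmas
import HarnessLib

/-!
# The prime-generic shift-equaliser law with coefficients in ANY `𝔽_p`-vector space
# (route `ManinLocalTwoThree`, cell bsd-f2-manin; cruxes C2 stmt-BirchSwinnertonDyer-22967 / C3 stmt-…-22968; LEAD seat p1 gen 12)

`primeShiftInvariantIsDiamond_holds` is stated over `ℤ/p`.  Since `IsDiamond` is a vanishing condition, the law transfers to every
`ℤ/p`-module `V` of coefficients (e.g. `𝔽_q`, `𝔽_p[ε]`) by composing with linear functionals (`Module.Projective.exists_dual_ne_zero`):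
**`shiftInvariantIsDiamondAt_of_module`** — for every prime `p`, every `N` and every additive `p`-shift-invariant `φ : Γ₀(N) → V`, `φ`
vanishes on `Γ₁(N)`.  Nothing about BSD, Manin's conjecture or C2/C3 is asserted (structure theorem about `Γ₀(N)`).
[cite: DarmonDiamondTaylor1995, Lemma 4.28 (p. 135) (shape only)]
-/

set_option autoImplicit false
set_option linter.dupNamespace false

open scoped MatrixGroups

open CongruenceSubgroup Matrix.SpecialLinearGroup
  Summit.BirchSwinnertonDyer.Rank1Residual.ManinAdditive.NineShiftEqualiser

namespace Summit.BirchSwinnertonDyer.BirchSwinnertonDyer.Theorems.ManinLocalTwoThree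

open Summit.BirchSwinnertonDyer.Rank1Residual.ManinAdditive

/-- **`K_p(N) = D(N)` with coefficients in any `ℤ/p`-module `V`** (every prime `p`, every level `N`). [new: corollary by linear functionals] -/
theorem shiftInvariantIsDiamondAt_of_module {p : ℕ} [Fact p.Prime] (V : Type*) [AddCommGroup V] [Module (ZMod p) V] (N : ℕ) :
    ShiftEqualiser.ShiftInvariantIsDiamondAt V (p : ℤ) N := by
  have hp : p.Prime := Fact.out
  intro φ hadd hinv γ hγ
  by_contra hne
  obtain ⟨f, hf⟩ := Module.Projective.exists_dual_ne_zero (ZMod p) hne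
  refine hf (primeShiftInvariantIsDiamond_holds p hp N (fun g => f (φ g)) (fun g h => ?_) (fun a b c d hdet hc => ?_) γ hγ)
  · show f (φ (g * h)) = f (φ g) + f (φ h)
    rw [hadd g h, map_add]
  · show f (φ _) = f (φ _)
    rw [hinv a b c d hdet hc]

end Summit.BirchSwinnertonDyer.BirchSwinnertonDyer.Theorems.ManinLocalTwoThree
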